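import Literature.Geometry.DiscreteGeometry.DelsarteLinearProgrammingBound
import HarnessLib

/-!
# The linear programming bound for potential energy on the sphere
(Yudin 1992; Cohn–Kumar, J. Amer. Math. Soc. 20 (2007), Prop. 4.1)

For a finite set `C ⊂ S^{n-1}` of unit vectors and a potential function `f`, the
`f`-potential energy of `C` in the convention of Cohn–Kumar (each pair counted in both orders) is
`E_f(C) = Σ_{x, y ∈ C, x ≠ y} f(|x - y|²)`.

**Theorem (Yudin 1992; Cohn–Kumar 2007, Proposition 4.1).** Let `n ≥ 3`, `μ = n/2 - 1`, let
`f` be any real function and let `h(t) = Σ_{k=0}^{d} α_k C_k^{μ}(t)` (`C_k^{μ}` the Gegenbauer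
/ ultraspherical polynomials of `S^{n-1}`, in the tree `gegenbauerSum μ k`) with `α_k ≥ 0` for
all `k` and `h(t) ≤ f(2 - 2t)` for all `t ∈ [-1, 1)`. Then every set of `N` points on `S^{n-1}`
has `f`-potential energy at least `N² α_0 - N h(1)`.

*Proof (as printed, loc. cit.; the same "main identity" as the Delsarte bound).* With
`S = Σ_{x,y ∈ C} h(⟨x,y⟩)`: splitting off the diagonal and using `h(⟨x,y⟩) ≤ f(|x-y|²)` for
`x ≠ y` (distinct unit vectors have `⟨x,y⟩ ∈ [-1,1)` and `|x-y|² = 2 - 2⟨x,y⟩`) gives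
`S ≤ N h(1) + E_f(C)`; expanding in the Gegenbauer basis and using the positive semidefiniteness
of each zonal kernel `C_k^{μ}(⟨x,y⟩)` (Schoenberg; in the tree
`Literature.Geometry.DiscreteGeometry.DelsarteLP.sum_sum_gegenbauerSum_nonneg`) gives
`S ≥ α_0 N²`.

What is here: the bound for a `Finset` of an arbitrary index type mapped injectively to unit
coordinate vectors (`EnergyLP.energy_ge_coord`, potential as a function `a` of the inner
product), for `Finset`s of `EuclideanSpace ℝ (Fin n)` with the potential a function of the inner
product (`EnergyLP.energy_ge_inner`) and, literally as printed, a function `f` of the squared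
distance (`EnergyLP.energy_ge`). Everything is proved; no named facts. Not here: the case
`n = 2` (Chebyshev normalisation), sharpness for the sharp configurations (Cohn–Kumar Thm. 1.2),
and the choice of optimal `h` (an infinite-dimensional LP).

## References
* V. A. Yudin, *Minimum potential energy of a point system of charges*, Diskret. Mat. 4 (1992)
  115–121; Discrete Math. Appl. 3 (1993) 75–81. [`Yudin1993`]
* H. Cohn, A. Kumar, *Universally optimal distribution of points on spheres*, J. Amer. Math.
  Soc. 20 (2007) 99–148, Proposition 4.1. [`CohnKumar2006`]
-/

noncomputable section

open Finset
open scoped RealInnerProductSpace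

namespace Literature.Geometry.DiscreteGeometry

namespace EnergyLP

open Literature.Analysis.SpecialFunctions

variable {n : ℕ} {μ : ℝ}

/-- Two unit coordinate vectors have `Σ x_k y_k ≥ -1` (from `Σ (x_k + y_k)² ≥ 0`). [folklore] -/
private theorem neg_one_le_dot (x y : Fin n → ℝ) (hx : ∑ k, x k ^ 2 = 1) (hy : ∑ k, y k ^ 2 = 1) :
    -1 ≤ ∑ k, x k * y k := by
  have h : 0 ≤ ∑ k, (x k + y k) ^ 2 := Finset.sum_nonneg fun k _ => sq_nonneg _
  have hx' : ∑ k, (x k + y k) ^ 2 = ∑ k, x k ^ 2 + ∑ k, y k ^ 2 + 2 * ∑ k, x k * y k := by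
    rw [Finset.mul_sum, ← Finset.sum_add_distrib, ← Finset.sum_add_distrib]
    exact Finset.sum_congr rfl fun k _ => by ring
  rw [hx', hx, hy] at h
  linarith

/-- Two *distinct* unit coordinate vectors have `Σ x_k y_k < 1` (from `Σ (x_k - y_k)² > 0`).
[folklore] -/
private theorem dot_lt_one (x y : Fin n → ℝ) (hx : ∑ k, x k ^ 2 = 1) (hy : ∑ k, y k ^ 2 = 1)
    (hne : x ≠ y) : ∑ k, x k * y k < 1 := by
  obtain ⟨i, hi⟩ : ∃ i, x i ≠ y i := Function.ne_iff.mp hne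
  have h : 0 < ∑ k, (x k - y k) ^ 2 := by
    refine lt_of_lt_of_le ?_
      (Finset.single_le_sum (fun k _ => sq_nonneg (x k - y k)) (Finset.mem_univ i))
    exact lt_of_le_of_ne (sq_nonneg _) (Ne.symm (pow_ne_zero 2 (sub_ne_zero.mpr hi)))
  have hx' : ∑ k, (x k - y k) ^ 2 = ∑ k, x k ^ 2 + ∑ k, y k ^ 2 - 2 * ∑ k, x k * y k := by
    rw [Finset.mul_sum, ← Finset.sum_add_distrib, ← Finset.sum_sub_distrib]
    exact Finset.sum_congr rfl fun k _ => by ring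
  rw [hx', hx, hy] at h
  linarith

/-- **The linear programming bound for energy, coordinate form.** `n = 2μ + 2`, `μ > 0`;
`α_k ≥ 0`; `h(t) = Σ_{k ≤ d} α_k C_k^{μ}(t) ≤ a(t)` for `-1 ≤ t < 1`; a finite family `C` of
indices `p` carrying pairwise distinct unit coordinate vectors `x_p : Fin n → ℝ`
(`Σ_j x_{p,j}² = 1`). Then
`|C|² α_0 - |C| h(1) ≤ Σ_{p ∈ C} Σ_{q ∈ C, q ≠ p} a(Σ_j x_{p,j} x_{q,j})`.
[cite: CohnKumar2006, Proposition 4.1] -/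
theorem energy_ge_coord (hn : (n : ℝ) = 2 * μ + 2) (hμ : 0 < μ)
    (d : ℕ) (α : ℕ → ℝ) (hα : ∀ k, 0 ≤ α k) (a : ℝ → ℝ)
    (hH : ∀ t : ℝ, -1 ≤ t → t < 1 → ∑ k ∈ range (d + 1), α k * gegenbauerSum μ k t ≤ a t)
    {ι : Type*} [DecidableEq ι] (C : Finset ι) (x : ι → Fin n → ℝ)
    (hunit : ∀ p ∈ C, ∑ j, x p j ^ 2 = 1) (hinj : ∀ p ∈ C, ∀ q ∈ C, p ≠ q → x p ≠ x q) :
    (C.card : ℝ) ^ 2 * α 0 - (C.card : ℝ) * ∑ k ∈ range (d + 1), α k * gegenbauerSum μ k 1 ≤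
      ∑ p ∈ C, ∑ q ∈ C.erase p, a (∑ j, x p j * x q j) := by
  set F : ℝ → ℝ := fun t => ∑ k ∈ range (d + 1), α k * gegenbauerSum μ k t with hFdef
  set ip : ι → ι → ℝ := fun p q => ∑ j, x p j * x q j with hip
  have hdiag : ∀ p ∈ C, ip p p = 1 := fun p hp => by
    simp only [hip, ← sq]; exact hunit p hp
  -- Schoenberg positivity transported to sums over the Finset `C`
  have hpsd : ∀ k, 0 ≤ ∑ p ∈ C, ∑ q ∈ C, gegenbauerSum μ k (ip p q) := fun k => by
    have h := DelsarteLP.sum_sum_gegenbauerSum_nonneg hn hμ k (ι := C)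
      (fun p j => x (p : ι) j) (fun p => hunit p p.2)
    have hconv : ∑ p : C, ∑ q : C, gegenbauerSum μ k (∑ j, x (p : ι) j * x (q : ι) j) =
        ∑ p ∈ C, ∑ q ∈ C, gegenbauerSum μ k (ip p q) := by
      rw [← Finset.sum_coe_sort C (fun p => ∑ q ∈ C, gegenbauerSum μ k (ip p q))]
      refine Finset.sum_congr rfl fun p _ => ?_
      exact Finset.sum_coe_sort C (fun q => gegenbauerSum μ k (ip p q))
    rw [← hconv]; exact h
  -- lower bound `|C|² α₀ ≤ S`
  have hlow : (C.card : ℝ) ^ 2 * α 0 ≤ ∑ p ∈ C, ∑ q ∈ C, F (ip p q) := by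
    have hswap : ∑ p ∈ C, ∑ q ∈ C, F (ip p q) =
        ∑ k ∈ range (d + 1), α k * ∑ p ∈ C, ∑ q ∈ C, gegenbauerSum μ k (ip p q) := by
      have h1 : ∀ p, ∑ q ∈ C, F (ip p q) =
          ∑ k ∈ range (d + 1), ∑ q ∈ C, α k * gegenbauerSum μ k (ip p q) := fun p => by
        simp only [hFdef]; exact Finset.sum_comm
      rw [Finset.sum_congr rfl fun p _ => h1 p, Finset.sum_comm]
      refine Finset.sum_congr rfl fun k _ => ?_
      rw [Finset.mul_sum]
      exact Finset.sum_congr rfl fun p _ => by rw [Finset.mul_sum]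
    rw [hswap]
    have hterm : ∀ k ∈ range (d + 1), 0 ≤ α k * ∑ p ∈ C, ∑ q ∈ C, gegenbauerSum μ k (ip p q) :=
      fun k _ => mul_nonneg (hα k) (hpsd k)
    have h0 : α 0 * ∑ p ∈ C, ∑ q ∈ C, gegenbauerSum μ 0 (ip p q) = (C.card : ℝ) ^ 2 * α 0 := by
      simp only [gegenbauerSum_zero, Finset.sum_const, nsmul_eq_mul]
      ring
    rw [← h0]
    exact Finset.single_le_sum hterm (Finset.mem_range.2 (Nat.succ_pos d))
  -- upper bound `S ≤ |C| h(1) + E`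
  have hupp : ∑ p ∈ C, ∑ q ∈ C, F (ip p q) ≤
      (C.card : ℝ) * F 1 + ∑ p ∈ C, ∑ q ∈ C.erase p, a (ip p q) := by
    have hrow : ∀ p ∈ C, ∑ q ∈ C, F (ip p q) ≤ F 1 + ∑ q ∈ C.erase p, a (ip p q) := fun p hp => by
      rw [← Finset.add_sum_erase _ _ hp, hdiag p hp]
      have hoff : ∑ q ∈ C.erase p, F (ip p q) ≤ ∑ q ∈ C.erase p, a (ip p q) :=
        Finset.sum_le_sum fun q hq => by
          have hqp : q ≠ p := Finset.ne_of_mem_erase hq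
          have hqC : q ∈ C := Finset.mem_of_mem_erase hq
          exact hH _ (neg_one_le_dot _ _ (hunit p hp) (hunit q hqC))
            (dot_lt_one _ _ (hunit p hp) (hunit q hqC) (hinj p hp q hqC hqp.symm))
      linarith
    calc ∑ p ∈ C, ∑ q ∈ C, F (ip p q) ≤ ∑ p ∈ C, (F 1 + ∑ q ∈ C.erase p, a (ip p q)) :=
          Finset.sum_le_sum hrow
      _ = (C.card : ℝ) * F 1 + ∑ p ∈ C, ∑ q ∈ C.erase p, a (ip p q) := by
        rw [Finset.sum_add_distrib, Finset.sum_const, nsmul_eq_mul]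
  have h := hlow.trans hupp
  linarith

/-- **The linear programming bound for energy** (`Finset` form, potential as a function of the
inner product). If `n = 2μ + 2` with `μ > 0`, `α_k ≥ 0`, and
`Σ_{k ≤ d} α_k C_k^{μ}(t) ≤ a(t)` for `-1 ≤ t < 1`, then every finite set `C` of unit vectors
of `ℝⁿ` satisfies `|C|² α_0 - |C| Σ_k α_k C_k^{μ}(1) ≤ Σ_{x ≠ y ∈ C} a(⟨x, y⟩)`.
[cite: CohnKumar2006, Proposition 4.1] -/
theorem energy_ge_inner [DecidableEq (EuclideanSpace ℝ (Fin n))]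
    (hn : (n : ℝ) = 2 * μ + 2) (hμ : 0 < μ)
    (d : ℕ) (α : ℕ → ℝ) (hα : ∀ k, 0 ≤ α k) (a : ℝ → ℝ)
    (hH : ∀ t : ℝ, -1 ≤ t → t < 1 → ∑ k ∈ range (d + 1), α k * gegenbauerSum μ k t ≤ a t)
    (C : Finset (EuclideanSpace ℝ (Fin n))) (h1 : ∀ x ∈ C, ‖x‖ = 1) :
    (C.card : ℝ) ^ 2 * α 0 - (C.card : ℝ) * ∑ k ∈ range (d + 1), α k * gegenbauerSum μ k 1 ≤
      ∑ x ∈ C, ∑ y ∈ C.erase x, a (inner ℝ x y) := by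
  have key := energy_ge_coord hn hμ d α hα a hH C (fun v j => v j) ?_ ?_
  · have hinner : ∀ x y : EuclideanSpace ℝ (Fin n), inner ℝ x y = ∑ j, x j * y j := fun x y => by
      simp [PiLp.inner_apply, mul_comm]
    simpa only [hinner] using key
  · intro p hp
    rw [← EuclideanSpace.real_norm_sq_eq, h1 p hp, one_pow]
  · intro p _ q _ hpq hxy
    exact hpq (PiLp.ext fun j => congrFun hxy j)

/-- **The linear programming bound for energy, as printed** (Cohn–Kumar 2007, Prop. 4.1):
`f` any real function of the squared distance; `h(t) = Σ_{k ≤ d} α_k C_k^{n/2-1}(t)` with all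
`α_k ≥ 0` and `h(t) ≤ f(2 - 2t)` for `t ∈ [-1, 1)`; then every finite `C ⊂ S^{n-1}` (`n ≥ 3`,
written `n = 2μ + 2`, `μ > 0`) has
`Σ_{x, y ∈ C, x ≠ y} f(|x - y|²) ≥ |C|² α_0 - |C| h(1)`.
[cite: CohnKumar2006, Proposition 4.1] -/
theorem energy_ge [DecidableEq (EuclideanSpace ℝ (Fin n))]
    (hn : (n : ℝ) = 2 * μ + 2) (hμ : 0 < μ)
    (d : ℕ) (α : ℕ → ℝ) (hα : ∀ k, 0 ≤ α k) (f : ℝ → ℝ)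
    (hH : ∀ t : ℝ, -1 ≤ t → t < 1 →
      ∑ k ∈ range (d + 1), α k * gegenbauerSum μ k t ≤ f (2 - 2 * t))
    (C : Finset (EuclideanSpace ℝ (Fin n))) (h1 : ∀ x ∈ C, ‖x‖ = 1) :
    (C.card : ℝ) ^ 2 * α 0 - (C.card : ℝ) * ∑ k ∈ range (d + 1), α k * gegenbauerSum μ k 1 ≤
      ∑ x ∈ C, ∑ y ∈ C.erase x, f (‖x - y‖ ^ 2) := by
  have key := energy_ge_inner hn hμ d α hα (fun t => f (2 - 2 * t)) hH C h1
  refine key.trans (le_of_eq ?_)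
  refine Finset.sum_congr rfl fun x hx => Finset.sum_congr rfl fun y hy => ?_
  have hyC : y ∈ C := Finset.mem_of_mem_erase hy
  have hsq : ‖x - y‖ ^ 2 = 2 - 2 * inner ℝ x y := by
    rw [@norm_sub_sq_real, h1 x hx, h1 y hyC]; ring
  rw [hsq]

end EnergyLP

end Literature.Geometry.DiscreteGeometry

end
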